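import Summits.Ventures.HodgeRepro2.T6N3MultHs

/-!
# T6N3HsSplice — the `hs` binder of the landed N3 mains, produced from the `hs` lane (proof lane)

Cell pub-hodge-repro2, Tier 6 (README §10), seat t6-p3 (N3 owner, M2). Filed in WAVE 1 (the opener
INBOX l. 97 / STATUS l. 12740; TARGET-T6.md v1.5 §11.0 decision (7)), for the lead's recomposition
(STATUS l. 12810 (4), the ask to t6-p3): the landed N3 mains (`T6N3Main` / `T6N3Main2` /
`T6N3Main3`) take the Π_s binder `hs : ∀ P′ ∈ R.Ps, ∀ π, R.mem π P′ → R.m π ≤ 1` and compute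
`R.multLeOne_of_displays hR0 hR1 hR2 hs` themselves; the successor statement therefore only needs
`hs` AS A TERM of the `hs` lane — `T.hs_of_identity hR0 hR1 hR2 hI hE hLI hU hOne` with `R := T.R` —
and the mains' calls stay byte-identical. Count-neutral: one theorem, no definition, no display.

§8(d): uses an L-value-free non-vanishing device: NO.
-/

namespace Summit.Ventures.HodgeRepro2.T6.RogawskiTrace

variable (T : RogawskiTrace)

/-- THE SPLICE: the Π_s binder `hs` of `T6N3Main.N3iso_main` / `T6N3Main2.N3iso_main₂` /
`T6N3Main3.N3iso_main₃` (residual row 27 of the M2 census) as a term of the `hs` lane — the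
infinite-dimensional packets by `m_le_one_of_identity` (the displayed identity + the packet-trace
expansion + `CharLinIndep` + `MembersUnramified`), the one-dimensional ones by `OneDimMultLeOne`.
The three Rogawski displays are not needed here (they enter through `multLeOne_of_displays` inside
the mains); they are not taken. -/
theorem hs_of_identity (hI : Hyp.Rogawski1990_Prop14_6_2_Identity T)
    (hE : Hyp.Rogawski1990_Sec13_3_PacketTrace T) (hLI : T.CharLinIndep) (hU : T.MembersUnramified)
    (hOne : T.OneDimMultLeOne) :
    ∀ P' ∈ T.R.Ps, ∀ π, T.R.mem π P' → T.R.m π ≤ 1 := fun P' hP π hπ => by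
  by_cases hd : T.oneDim P'
  · exact hOne P' hP hd π hπ
  · exact T.m_le_one_of_identity hI hE hLI hU hP hd hπ

/-- `multLeOne_of_identity` is `multLeOne_of_displays` on the splice (the two agree by definition). -/
theorem multLeOne_of_identity_eq (h0 : Hyp.Rogawski1990_Sec14_6_Partition T.R)
    (h1 : Hyp.Rogawski1990_Thm14_6_4 T.R) (h2 : Hyp.Rogawski1990_Thm14_6_5 T.R)
    (hI : Hyp.Rogawski1990_Prop14_6_2_Identity T) (hE : Hyp.Rogawski1990_Sec13_3_PacketTrace T)
    (hLI : T.CharLinIndep) (hU : T.MembersUnramified) (hOne : T.OneDimMultLeOne) :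
    T.R.multLeOne_of_displays h0 h1 h2 (T.hs_of_identity hI hE hLI hU hOne) =
      T.multLeOne_of_identity h0 h1 h2 hI hE hLI hU hOne := rfl

end Summit.Ventures.HodgeRepro2.T6.RogawskiTrace
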